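import Literature.Topology.FourManifolds.FrameCharacterParam
import Literature.Topology.FourManifolds.BasinConeParam
import Literature.Topology.FourManifolds.CoupleSaddleRegions
import Literature.Topology.FourManifolds.BoundaryPlanarisationCores

/-!
# The orientation law of the two entrance sheets of a saddle (dimension `3`)

Topic `Literature/Topology/FourManifolds` (support of `stmt-SmoothPoincare4-15190`, structure
conjugacy; the crux of the construction of the sphere diffeomorphism).  Everything here is
**proved**.

Let `W` be an *oriented* compact `3`-manifold with boundary carrying one-level saddle data `Q`
of a basin pair `P` (boxes of index `1`), and `s` a saddle.  The Milnor chart of `s` and the cone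
parametrisation of the punctured basin of `P.A` (`BasinConeParam.lean`) are two parametrisations
by `ℝ³` with connected domains — the `3ε`-ball, resp. a spherical shell below the saddle value —
both containing the two entrance points `entW s b 0` (`b = true, false`) of the core of `s`.  By
the frame-character bookkeeping of `FrameCharacterParam.lean` the orientation characters of
both pushed frames are constant on these domains, so **the transition Jacobians
`J_b = d(coneInv ∘ pt_s)` at the two entrance points have determinants of the same sign**:

* `BasinPair.SaddleData.det_transition_pos_iff` — `0 < det J_true ↔ 0 < det J_false`.

This is the form in which orientability of `W` enters the matching of the germs of the direction
map at the two core directions of one saddle by *one* change of the Milnor chart.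

## References

* M. W. Hirsch, *Differential Topology*, GTM 33 (1976), Ch. 4 §4. [HirschDT1976]
* J. Milnor, *Lectures on the h-cobordism theorem* (1965), Def. 3.1, Def. 3.9, proof of
  Thm. 3.12 (PDF pp. 12–18). [MilnorHCobordism1965]
-/

open scoped Manifold ContDiff Topology
open Set Function Filter Metric Module

noncomputable section

namespace Literature.Topology.FourManifolds

open Cobordism FourManifolds.Flow TracePolar

universe u

namespace BasinPair.SaddleData

variable {W : Type u} [TopologicalSpace W] [T2Space W] [SecondCountableTopology W]
  [CompactSpace W] [ChartedSpace (EuclideanHalfSpace (2 + 1)) W] [IsManifold (𝓡∂ (2 + 1)) ∞ W]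
  {g : W → ℝ} {ξA ξB : Π x : W, TangentSpace (𝓡∂ (2 + 1)) x} {P : BasinPair g ξA ξB} (Q : P.SaddleData)

/-- Local notation for the model space. -/
local notation "E3" => EuclideanSpace ℝ (Fin 3)

/-! ### The Milnor chart as a parametrisation -/

variable {s : SaddlePt 2 g}

/-- The inverse Milnor chart `pt` is smooth on the open `3ε`-ball. [folklore] -/
theorem contMDiffAt_pt {u : E3} (hu : ‖u‖ < 3 * Q.ε) : ContMDiffAt 𝓘(ℝ, E3) (𝓡∂ (2 + 1)) ∞ (Q.DA s).pt u := by
  have hc : (Q.DA s).center + u ∈ ball ((Q.DA s).chart.extend (𝓡∂ (2 + 1)) s.1) (3 * (Q.DA s).ε) := by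
    rw [mem_ball, dist_eq_norm, MilnorBox.center, add_sub_cancel_left, Q.εA]; exact hu
  have h1 : ContMDiffAt 𝓘(ℝ, E3) 𝓘(ℝ, E3) ∞ (fun u : E3 => (Q.DA s).center + u) u := contMDiffAt_const.add contMDiffAt_id
  exact ((Q.DA s).contMDiffAt_extend_symm hc).comp u h1

/-- The inverse Milnor chart is smooth on the open `3ε`-ball, as an `On` statement. [folklore] -/
theorem contMDiffOn_pt : ContMDiffOn 𝓘(ℝ, E3) (𝓡∂ (2 + 1)) ∞ (Q.DA s).pt (ball (0 : E3) (3 * Q.ε)) :=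
  fun u hu => (Q.contMDiffAt_pt (by rwa [mem_ball_zero_iff] at hu)).contMDiffWithinAt

/-- The Milnor coordinates are smooth at points of the chart domain. [folklore] -/
theorem contMDiffAt_coord {z : W} (hz : z ∈ (Q.DA s).chart.source) :
    ContMDiffAt (𝓡∂ (2 + 1)) 𝓘(ℝ, E3) ∞ (Q.DA s).coord z :=
  ((Q.DA s).chart.contMDiffAt_extend (Q.DA s).mem_maximalAtlas hz).sub contMDiffAt_const

/-- `coord ∘ pt = id` near every point of the open `3ε`-ball. [folklore] -/
theorem coord_pt_eventuallyEq {u : E3} (hu : ‖u‖ < 3 * Q.ε) : ((Q.DA s).coord ∘ (Q.DA s).pt) =ᶠ[𝓝 u] id := by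
  have ho : IsOpen {v : E3 | ‖v‖ < 3 * Q.ε} := isOpen_lt continuous_norm continuous_const
  filter_upwards [ho.mem_nhds hu] with v hv
  exact (Q.DA s).coord_pt_of_norm_le (by rw [Q.εA]; exact le_of_lt hv)

/-- **The pushed frame of the inverse Milnor chart is non-degenerate on the `3ε`-ball.** [folklore] -/
theorem det_pushFrame_pt_ne_zero {u : E3} (hu : ‖u‖ < 3 * Q.ε) :
    (finBasis ℝ E3).det (pushFrame (𝓡∂ (2 + 1)) (Q.DA s).pt u) ≠ 0 :=
  det_pushFrame_ne_zero_of_comp_eq_id ((Q.contMDiffAt_pt hu).mdifferentiableAt (by simp))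
    ((Q.contMDiffAt_coord ((Q.DA s).pt_mem_source_of_norm_le (by rw [Q.εA]; exact hu.le))).mdifferentiableAt (by simp))
    (Q.coord_pt_eventuallyEq hu)

/-! ### The entrance points in the two parametrisations -/

variable (hk : (Q.DA s).k = 1) {b : Bool}
include hk

/-- The level of `pt u` near the entrance points: `g (pt u) = c + Q(u)`. [folklore] -/
theorem apply_pt {u : E3} (hu : ‖u‖ ≤ 3 * Q.ε) : g ((Q.DA s).pt u) = Q.c + milnorQuadratic 1 u := by
  rw [(Q.DA s).apply_pt_of_norm_le (by rw [Q.εA]; exact hu), Q.apply_eq_c, hk]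

omit hk in
/-- **The entrance point `entW s b 0` read in the Milnor chart is `entPoint ε b 0`**, of norm `ε`. [folklore] -/
theorem pt_entPoint_zero (b : Bool) : (Q.DA s).pt (entPoint Q.ε b 0) = Q.entW s b 0 := rfl

omit hk in
/-- The entrance vector `entPoint ε b 0` has norm `ε`. [folklore] -/
theorem norm_entPoint_zero (b : Bool) : ‖entPoint Q.ε b (0 : EuclideanSpace ℝ (Fin 2))‖ = Q.ε := by
  have h := norm_entPoint_sq Q.ε b (0 : EuclideanSpace ℝ (Fin 2))
  rw [norm_zero] at h
  have h2 : ‖entPoint Q.ε b (0 : EuclideanSpace ℝ (Fin 2))‖ ^ 2 = Q.ε ^ 2 := by rw [h]; ring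
  have := Q.ε_pos
  nlinarith [norm_nonneg (entPoint Q.ε b (0 : EuclideanSpace ℝ (Fin 2)))]

omit hk in
/-- The entrance vector lies in the open `3ε`-ball. [folklore] -/
theorem norm_entPoint_zero_lt (b : Bool) : ‖entPoint Q.ε b (0 : EuclideanSpace ℝ (Fin 2))‖ < 3 * Q.ε := by
  have h : ‖(0 : EuclideanSpace ℝ (Fin 2))‖ ^ 2 < Q.ε ^ 2 := by rw [norm_zero]; simpa using Q.sq_pos
  exact norm_entPoint_lt Q.ε_pos b h

/-- **Near the entrance vector, the points `pt u` are basin points other than `p₀` below `hi`.** [folklore] -/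
theorem eventually_pt_mem_basin (b : Bool) : ∀ᶠ u in 𝓝 (entPoint Q.ε b (0 : EuclideanSpace ℝ (Fin 2))),
    (Q.DA s).pt u ∈ P.A.basin ∧ (Q.DA s).pt u ≠ P.A.p₀ ∧ g ((Q.DA s).pt u) < P.A.hi := by
  set u₀ : E3 := entPoint Q.ε b (0 : EuclideanSpace ℝ (Fin 2)) with hu₀
  have hu₀n : ‖u₀‖ < 3 * Q.ε := Q.norm_entPoint_zero_lt b
  have hcont : ContinuousAt (fun u : E3 => g ((Q.DA s).pt u)) u₀ :=
    (P.A.isMorseFunction.isMorse.contMDiff.continuous.continuousAt).comp (Q.contMDiffAt_pt hu₀n).continuousAt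
  have hval : g ((Q.DA s).pt u₀) = Q.c - Q.ε ^ 2 := by
    rw [Q.apply_pt hk hu₀n.le, hu₀, milnorQuadratic_entPoint]; ring
  have h1 : ∀ᶠ u in 𝓝 u₀, g ((Q.DA s).pt u) < Q.c := by
    refine hcont.eventually (eventually_lt_nhds ?_)
    show g ((Q.DA s).pt u₀) < Q.c
    rw [hval]; exact sub_lt_self _ Q.sq_pos
  have h2 : ∀ᶠ u in 𝓝 u₀, Q.c - 9 * Q.ε ^ 2 ≤ g ((Q.DA s).pt u) := by
    filter_upwards [(isOpen_lt continuous_norm continuous_const).mem_nhds hu₀n] with u hu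
    have h := Q.abs_apply_sub_c_le_A s ((Q.DA s).pt_mem_source_of_norm_le (by rw [Q.εA]; exact le_of_lt hu))
      (by rw [(Q.DA s).coord_pt_of_norm_le (by rw [Q.εA]; exact le_of_lt hu)]; exact le_of_lt hu)
    rw [abs_le] at h; linarith [h.1]
  filter_upwards [h1, h2] with u hu1 hu2
  have hsph : P.A.sph < g ((Q.DA s).pt u) := lt_of_lt_of_le Q.sph_lt hu2
  refine ⟨Q.mem_basin_of_apply_lt_c hu1, fun h => ?_, hu1.trans Q.c_lt_hi⟩
  rw [h] at hsph; exact lt_asymm hsph P.A.apply_p₀_lt_sph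

/-- The entrance point is a basin point other than `p₀` below `hi`. [folklore] -/
theorem entW_zero_mem_basin (b : Bool) :
    Q.entW s b 0 ∈ P.A.basin ∧ Q.entW s b 0 ≠ P.A.p₀ ∧ g (Q.entW s b 0) < P.A.hi := by
  have h := (Q.eventually_pt_mem_basin hk b).self_of_nhds
  exact h

/-- The cone coordinate of the entrance point has norm `c - ε² - g p₀`. [folklore] -/
theorem norm_coneInv_entW_zero (b : Bool) : ‖P.A.coneInv (Q.entW s b 0)‖ = Q.c - Q.ε ^ 2 - g P.A.p₀ := by
  obtain ⟨h1, h2, h3⟩ := Q.entW_zero_mem_basin hk b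
  rw [P.A.norm_coneInv h1 h2 h3, Q.apply_entW hk (by rw [norm_zero]; simpa using Q.sq_pos), entLevel_def]

/-! ### The shell below the saddle value lies in the cone domain -/

omit hk in
/-- **The spherical shell of cone coordinates of levels in `(g p₀, c)` lies in the cone domain**: every
ray meets every level below the saddle value. [cite: MilnorHCobordism1965, Thm. 4.1 (PDF p. 22)] -/
theorem shell_subset_coneDom : {w : E3 | 0 < ‖w‖ ∧ ‖w‖ < Q.c - g P.A.p₀} ⊆ P.A.coneDom := by
  rintro w ⟨hw0, hwc⟩
  have hw : w ≠ 0 := norm_pos_iff.1 hw0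
  have hv : ‖(P.A.rad / ‖w‖) • w‖ = P.A.rad := P.A.norm_rad_div_smul hw
  refine ⟨hw, by linarith [Q.c_lt_hi], ?_⟩
  have h1 : g (P.A.ofChart ((P.A.rad / ‖w‖) • w)) ∈ Ioo (g P.A.p₀) Q.c := by
    rw [(P.A.apply_ofChart_eq_sphR_iff (P.A.norm_lt_r₀_of_eq_rad hv).le).2 hv]
    exact ⟨P.A.sphR_mem_Ioo.1, P.A.sphR_lt_sph.trans Q.sph_lt_c⟩
  exact Q.hits_A_of_mem_Ioo_p₀_c h1 ⟨by linarith, by linarith⟩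

omit hk in
/-- The shell is open. [folklore] -/
theorem isOpen_shell : IsOpen {w : E3 | 0 < ‖w‖ ∧ ‖w‖ < Q.c - g P.A.p₀} :=
  (isOpen_lt continuous_const continuous_norm).inter (isOpen_lt continuous_norm continuous_const)

omit hk in
/-- The shell is preconnected. [folklore] -/
theorem isPreconnected_shell' : IsPreconnected {w : E3 | 0 < ‖w‖ ∧ ‖w‖ < Q.c - g P.A.p₀} := by
  have hrank : 1 < Module.rank ℝ E3 := by
    rw [← Module.finrank_eq_rank, finrank_euclideanSpace_fin]; norm_num
  exact isPreconnected_shell hrank le_rfl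

omit hk in
variable (P) in
/-- **The pushed frame of the cone parametrisation is non-degenerate on the cone domain.** [folklore] -/
theorem det_pushFrame_coneParam_ne_zero {w : E3} (hw : w ∈ P.A.coneDom) :
    (finBasis ℝ E3).det (pushFrame (𝓡∂ (2 + 1)) P.A.coneParam w) ≠ 0 := by
  obtain ⟨h1, h2, h3⟩ := P.A.coneParam_mem_basin hw
  exact det_pushFrame_ne_zero_of_comp_eq_id ((P.A.contMDiffAt_coneParam hw).mdifferentiableAt (by simp))
    ((P.A.contMDiffAt_coneInv h1 h2 (by rw [h3]; exact hw.2.1)).mdifferentiableAt (by simp)) (P.A.coneInv_coneParam_eventuallyEq hw)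

/-! ### The transition Jacobians at the two entrance points have the same sign -/

/-- **The transition map** from the Milnor chart of `s` to the cone coordinates of `A`. [folklore] -/
def transition (Q : P.SaddleData) (s : SaddlePt 2 g) : E3 → E3 := P.A.coneInv ∘ (Q.DA s).pt

omit hk in
/-- Unfolding `transition`. [folklore] -/
theorem transition_def (u : E3) : Q.transition s u = P.A.coneInv ((Q.DA s).pt u) := rfl

/-- **The orientation law of the entrance sheets.**  For an oriented `W`, the Jacobian
determinants of the transition map `coneInv ∘ pt_s` at the two entrance vectors
`entPoint ε true 0`, `entPoint ε false 0` have the same sign. [cite: HirschDT1976, Ch. 4 §4 (after Lemma 4.1)] [cite: MilnorHCobordism1965, Def. 3.9, proof of Thm. 3.12] -/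
theorem det_transition_pos_iff (o : SmoothOrientation (𝓡∂ (2 + 1)) W) :
    (0 < LinearMap.det (M := E3) (mfderiv 𝓘(ℝ, E3) 𝓘(ℝ, E3) (Q.transition s) (entPoint Q.ε true 0)).toLinearMap) ↔
      (0 < LinearMap.det (M := E3) (mfderiv 𝓘(ℝ, E3) 𝓘(ℝ, E3) (Q.transition s) (entPoint Q.ε false 0)).toLinearMap) := by
  -- for each end `b`: the transition rule at the entrance vector
  have key : ∀ b : Bool,
      (o.IsPosFrame ((Q.DA s).pt (entPoint Q.ε b 0)) (pushFrame (𝓡∂ (2 + 1)) (Q.DA s).pt (entPoint Q.ε b 0)) ↔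
        (o.IsPosFrame (P.A.coneParam (Q.transition s (entPoint Q.ε b 0)))
            (pushFrame (𝓡∂ (2 + 1)) P.A.coneParam (Q.transition s (entPoint Q.ε b 0))) ↔
          0 < LinearMap.det (M := E3) (mfderiv 𝓘(ℝ, E3) 𝓘(ℝ, E3) (Q.transition s) (entPoint Q.ε b 0)).toLinearMap)) ∧
      Q.transition s (entPoint Q.ε b 0) ∈ {w : E3 | 0 < ‖w‖ ∧ ‖w‖ < Q.c - g P.A.p₀} := by
    intro b
    set u₀ : E3 := entPoint Q.ε b 0 with hu₀
    have hu₀n : ‖u₀‖ < 3 * Q.ε := Q.norm_entPoint_zero_lt b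
    obtain ⟨hb1, hb2, hb3⟩ := Q.entW_zero_mem_basin hk b
    have hx : (Q.DA s).pt u₀ = Q.entW s b 0 := rfl
    -- the transition value and its membership in the shell
    have hw : Q.transition s u₀ = P.A.coneInv (Q.entW s b 0) := rfl
    have hwdom : Q.transition s u₀ ∈ P.A.coneDom := by rw [hw]; exact P.A.coneInv_mem_coneDom hb1 hb2 hb3
    have hshell : Q.transition s u₀ ∈ {w : E3 | 0 < ‖w‖ ∧ ‖w‖ < Q.c - g P.A.p₀} := by
      rw [hw]; refine ⟨?_, ?_⟩
      · rw [Q.norm_coneInv_entW_zero hk b]; linarith [Q.apply_p₀_lt_c_sub_sq]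
      · rw [Q.norm_coneInv_entW_zero hk b]; linarith [Q.sq_pos]
    -- smoothness of the three maps
    have hpt : ContMDiffAt 𝓘(ℝ, E3) (𝓡∂ (2 + 1)) ∞ (Q.DA s).pt u₀ := Q.contMDiffAt_pt hu₀n
    have hinv : ContMDiffAt (𝓡∂ (2 + 1)) 𝓘(ℝ, E3) ∞ P.A.coneInv ((Q.DA s).pt u₀) := by
      rw [hx]; exact P.A.contMDiffAt_coneInv hb1 hb2 hb3
    have htr : ContMDiffAt 𝓘(ℝ, E3) 𝓘(ℝ, E3) ∞ (Q.transition s) u₀ := hinv.comp u₀ hpt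
    have hpar : ContMDiffAt 𝓘(ℝ, E3) (𝓡∂ (2 + 1)) ∞ P.A.coneParam (Q.transition s u₀) := P.A.contMDiffAt_coneParam hwdom
    -- `pt = coneParam ∘ transition` near `u₀`
    have heq : (Q.DA s).pt =ᶠ[𝓝 u₀] (P.A.coneParam ∘ Q.transition s) := by
      filter_upwards [Q.eventually_pt_mem_basin hk b] with u hu
      exact (P.A.coneParam_coneInv hu.1 hu.2.1 hu.2.2).symm
    have hchain : ∀ v : E3, mfderiv 𝓘(ℝ, E3) (𝓡∂ (2 + 1)) (Q.DA s).pt u₀ v =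
        mfderiv 𝓘(ℝ, E3) (𝓡∂ (2 + 1)) P.A.coneParam (Q.transition s u₀)
          (mfderiv 𝓘(ℝ, E3) 𝓘(ℝ, E3) (Q.transition s) u₀ v) := fun v => by
      have h1 : mfderiv 𝓘(ℝ, E3) (𝓡∂ (2 + 1)) (Q.DA s).pt u₀ = mfderiv 𝓘(ℝ, E3) (𝓡∂ (2 + 1)) (P.A.coneParam ∘ Q.transition s) u₀ :=
        heq.mfderiv_eq
      have h2 := mfderiv_comp u₀ (hpar.mdifferentiableAt (by simp)) (htr.mdifferentiableAt (by simp))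
      have h3 := ContinuousLinearMap.ext_iff.1 (h1.trans h2) v
      exact h3
    -- the pushed frame of `pt` is non-degenerate, hence so is the transition Jacobian
    have hdet₁ := Q.det_pushFrame_pt_ne_zero (s := s) hu₀n
    have hdet₂ := det_pushFrame_coneParam_ne_zero P hwdom
    have hJ0 : LinearMap.det (M := E3) (mfderiv 𝓘(ℝ, E3) 𝓘(ℝ, E3) (Q.transition s) u₀).toLinearMap ≠ 0 := by
      have hχ : ContMDiffAt 𝓘(ℝ, E3) 𝓘(ℝ, E3) ∞ ((Q.DA s).coord ∘ P.A.coneParam) (Q.transition s u₀) := by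
        refine (Q.contMDiffAt_coord ?_).comp _ hpar
        rw [show P.A.coneParam (Q.transition s u₀) = (Q.DA s).pt u₀ from (P.A.coneParam_coneInv hb1 hb2 hb3)]
        exact (Q.DA s).pt_mem_source_of_norm_le (by rw [Q.εA]; exact hu₀n.le)
      have hid : (((Q.DA s).coord ∘ P.A.coneParam) ∘ Q.transition s) =ᶠ[𝓝 u₀] id := by
        filter_upwards [Q.eventually_pt_mem_basin hk b, Q.coord_pt_eventuallyEq (s := s) hu₀n] with u hu hu'
        show (Q.DA s).coord (P.A.coneParam (P.A.coneInv ((Q.DA s).pt u))) = u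
        rw [P.A.coneParam_coneInv hu.1 hu.2.1 hu.2.2]; exact hu'
      have h := det_pushFrame_ne_zero_of_comp_eq_id (I := 𝓘(ℝ, E3)) (htr.mdifferentiableAt (by simp)) (hχ.mdifferentiableAt (by simp)) hid
      rwa [det_pushFrame] at h
    refine ⟨?_, hshell⟩
    have h := o.isPosFrame_pushFrame_iff_of_comp (ψ₁ := (Q.DA s).pt) (ψ₂ := P.A.coneParam) (u₁ := u₀)
      (u₂ := Q.transition s u₀) (heq.self_of_nhds) (mfderiv 𝓘(ℝ, E3) 𝓘(ℝ, E3) (Q.transition s) u₀) hchain hdet₂ hJ0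
    exact h
  -- constancy of the two characters
  obtain ⟨kt, mt⟩ := key true
  obtain ⟨kf, mf⟩ := key false
  have hpt : o.IsPosFrame ((Q.DA s).pt (entPoint Q.ε true 0)) (pushFrame (𝓡∂ (2 + 1)) (Q.DA s).pt (entPoint Q.ε true 0)) ↔
      o.IsPosFrame ((Q.DA s).pt (entPoint Q.ε false 0)) (pushFrame (𝓡∂ (2 + 1)) (Q.DA s).pt (entPoint Q.ε false 0)) :=
    o.isPosFrame_pushFrame_iff_of_isPreconnected isOpen_ball (convex_ball (0 : E3) (3 * Q.ε)).isPreconnected Q.contMDiffOn_pt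
      (fun u hu => Q.det_pushFrame_pt_ne_zero (by rwa [mem_ball_zero_iff] at hu))
      (by rw [mem_ball_zero_iff]; exact Q.norm_entPoint_zero_lt true) (by rw [mem_ball_zero_iff]; exact Q.norm_entPoint_zero_lt false)
  have hcone : o.IsPosFrame (P.A.coneParam (Q.transition s (entPoint Q.ε true 0)))
        (pushFrame (𝓡∂ (2 + 1)) P.A.coneParam (Q.transition s (entPoint Q.ε true 0))) ↔
      o.IsPosFrame (P.A.coneParam (Q.transition s (entPoint Q.ε false 0)))
        (pushFrame (𝓡∂ (2 + 1)) P.A.coneParam (Q.transition s (entPoint Q.ε false 0))) :=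
    o.isPosFrame_pushFrame_iff_of_isPreconnected Q.isOpen_shell Q.isPreconnected_shell'
      (P.A.contMDiffOn_coneParam.mono Q.shell_subset_coneDom)
      (fun w hw => det_pushFrame_coneParam_ne_zero P (Q.shell_subset_coneDom hw)) mt mf
  tauto

end BasinPair.SaddleData

end Literature.Topology.FourManifolds
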